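import Summits.ValiantsHypothesis.ValiantsHypothesis.Theorems.KPlusLogSqLawTropicalBLexStrict
import Summits.ValiantsHypothesis.ValiantsHypothesis.Theorems.KPlusLogSqLawTropicalBSplitDefs

/-!
# Route `KPlusLogSqLaw`, crux `TropicalB` — lex designs: chains with SHORT STEPS are linear in the size

HONEST FRAMING.  Support file toward the registered stubs `stub_tropThin` / `stub_tropFat` of the crux `TropicalB`
(ledger item `stmt-ValiantsHypothesis-19771`, route `KPlusLogSqLaw`; cell `pub-symmetroid`, seat val-sym-trop-p4, 2026-08-26).
A bound on a CHAIN CLASS inside the LEX regime (exponent values super-increasing by the size); it proves NEITHER stub and asserts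
nothing about `TropicalB` in general, `Lifting`, `KPlusLogSqLaw`, `MatrixDescartes` or `VP ≠ VNP`.

THE BOUND (`mul_steps_add_le_of_shortSteps`, `steps_le_of_shortSteps`).  Let the exponent values be super-increasing
(`d l < d l' ⇒ m·d l < d l'`) and let `p₀, …, pₙ` be a dominant sign-alternating chain (hypothesis list of `TropRootLawAt`)
EVERY STEP OF WHICH CHANGES AT MOST `ℓ` COLUMNS (in row or class: `#{i : (σₖ i, λₖ i) ≠ (σₖ₊₁ i, λₖ₊₁ i)} ≤ ℓ`).  Then

  `ℓ·n + m ≤ m·(ℓ+1)^K`,  hence `n ≤ m·(ℓ+1)^K` (`ℓ ≥ 1`).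

So in the lex regime the chain length is LINEAR in `m` for bounded step size — inside the `K + log₂² m` budget with
`C = ⌈log₂(ℓ+1)⌉ + 1`, whereas slope counting gives `C(m+K−1, K−1)`.  Contrapositive = the carry-cost principle made precise:
**a lex design beating `m·(ℓ+1)^K` must have a step (a carry) that changes more than `ℓ` columns at once.**

PROOF (odometer dynamics, no counting of states).  By the strict lex step (`exists_lex_strict_step`, `…TropicalBLexStrict`)
every step `k` has a LEVEL `L k` (an exponent value) whose column count rises while all higher counts stay.  The combinatorial
core is stated for an ARBITRARY level function with these two properties (`card_level_eq_le`, `mul_card_level_ge_add_le` —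
no dominance needed there): counts of values above the level of a step do not move at that step, and no count moves by more
than `ℓ` at any step (only changed columns change counts, `count_le_count_succ_add`).  For a value `V₀`: the steps of level
`V₀` each raise the count of `V₀`, the steps of lower level leave it, the steps of higher level lower it by at most `ℓ`;
telescoping the count of `V₀` (between `0` and `m`) gives `#{level = V₀} ≤ m + ℓ·#{level > V₀}`.  Descending over the at most
`K` exponent values: `ℓ·#{level ≥ V} + m ≤ m·(ℓ+1)^{#values ≥ V}`.

[folklore] (odometer / amortised digit counting).
-/

-- `Summit.ValiantsHypothesis.ValiantsHypothesis.…` repeats a component by the D-0017 layout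
-- (single-conjunct summit), which the `dupNamespace` linter flags; the name is mandated.
set_option linter.dupNamespace false
set_option autoImplicit false

namespace Summit.ValiantsHypothesis.ValiantsHypothesis.Theorems.LacunarySymmetroidMatrixDescartes.TropicalCensus

open Summit.ValiantsHypothesis.ValiantsHypothesis.Theorems.MatrixDescartes.Negative
open Finset

section ShortSteps

variable {m K : ℕ}

/-! ## 1. Combinatorics of a level function -/

/-- counts move by at most the number of changed columns: if a step changes at most `ℓ` columns (row or class), the count of
any value drops by at most `ℓ`. -/
theorem count_le_count_succ_add (d : Fin K → ℕ) {n : ℕ} (p : Fin (n + 1) → Equiv.Perm (Fin m) × (Fin m → Fin K)) (ℓ : ℕ)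
    (hℓ : ∀ k : Fin n, (univ.filter fun i : Fin m =>
      (p k.castSucc).1 i ≠ (p k.succ).1 i ∨ (p k.castSucc).2 i ≠ (p k.succ).2 i).card ≤ ℓ)
    (k : Fin n) (V : ℕ) :
    (univ.filter fun i => d ((p k.castSucc).2 i) = V).card ≤ (univ.filter fun i => d ((p k.succ).2 i) = V).card + ℓ := by
  calc (univ.filter fun i => d ((p k.castSucc).2 i) = V).card
      ≤ ((univ.filter fun i => d ((p k.succ).2 i) = V) ∪ (univ.filter fun i : Fin m =>
          (p k.castSucc).1 i ≠ (p k.succ).1 i ∨ (p k.castSucc).2 i ≠ (p k.succ).2 i)).card := by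
        refine card_le_card fun i hi => ?_
        rw [mem_union, mem_filter, mem_filter]
        rw [mem_filter] at hi
        by_cases hc : (p k.castSucc).2 i = (p k.succ).2 i
        · exact Or.inl ⟨mem_univ _, hc ▸ hi.2⟩
        · exact Or.inr ⟨mem_univ _, Or.inr hc⟩
    _ ≤ _ := (card_union_le _ _).trans (Nat.add_le_add_left (hℓ k) _)

/-- **per-value count.**  For a chain `p` and a «level» function `L` (at step `k` the count of the value `L k` rises and every
larger value's count is unchanged), with steps changing at most `ℓ` columns: the steps of level `V₀` number at most
`m + ℓ·#{steps of level > V₀}` (telescoping the count of `V₀`).  Pure combinatorics. [folklore] -/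
theorem card_level_eq_le (d : Fin K → ℕ) {n : ℕ} (p : Fin (n + 1) → Equiv.Perm (Fin m) × (Fin m → Fin K)) (ℓ : ℕ)
    (hℓ : ∀ k : Fin n, (univ.filter fun i : Fin m =>
      (p k.castSucc).1 i ≠ (p k.succ).1 i ∨ (p k.castSucc).2 i ≠ (p k.succ).2 i).card ≤ ℓ)
    (L : Fin n → ℕ)
    (hrise : ∀ k, (univ.filter fun i => d ((p k.castSucc).2 i) = L k).card <
      (univ.filter fun i => d ((p k.succ).2 i) = L k).card)
    (hstay : ∀ k D, L k < D →
      (univ.filter fun i => d ((p k.castSucc).2 i) = D).card = (univ.filter fun i => d ((p k.succ).2 i) = D).card)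
    (V₀ : ℕ) :
    (univ.filter fun k : Fin n => L k = V₀).card ≤ m + ℓ * (univ.filter fun k : Fin n => V₀ < L k).card := by
  -- the count of `V₀` along the chain, as an integer sequence
  set c : Fin (n + 1) → ℤ := fun j => ((univ.filter fun i => d ((p j).2 i) = V₀).card : ℤ) with hc
  set δ : Fin n → ℤ := fun k => c k.succ - c k.castSucc with hδ
  -- telescoping
  have htel : ∑ k, δ k = c (Fin.last n) - c 0 := by
    have h2 : ∑ j : Fin (n + 1), c j = c 0 + ∑ k : Fin n, c k.succ := Fin.sum_univ_succ c
    have h3 : ∑ j : Fin (n + 1), c j = ∑ k : Fin n, c k.castSucc + c (Fin.last n) := Fin.sum_univ_castSucc c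
    simp only [hδ, sum_sub_distrib]
    linarith
  have hcm : ∀ j, c j ≤ m := by
    intro j
    simp only [hc]
    have := card_le_univ (univ.filter fun i => d ((p j).2 i) = V₀)
    rw [Fintype.card_fin] at this
    exact_mod_cast this
  have hc0 : ∀ j, 0 ≤ c j := fun j => by simp only [hc]; positivity
  -- behaviour of δ by level
  have hup : ∀ k, L k = V₀ → 1 ≤ δ k := by
    intro k hk
    have := hrise k
    rw [hk] at this
    simp only [hδ, hc]
    omega
  have hstay' : ∀ k, L k < V₀ → δ k = 0 := by
    intro k hk
    have := hstay k V₀ hk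
    simp only [hδ, hc, this, sub_self]
  have hdrop : ∀ k, -(ℓ : ℤ) ≤ δ k := by
    intro k
    have := count_le_count_succ_add d p ℓ hℓ k V₀
    simp only [hδ, hc]
    omega
  -- split the sum by level
  have hsplit : ∑ k, δ k = ∑ k ∈ univ.filter (fun k => L k = V₀), δ k +
      (∑ k ∈ univ.filter (fun k => L k < V₀), δ k + ∑ k ∈ univ.filter (fun k => V₀ < L k), δ k) := by
    rw [← sum_filter_add_sum_filter_not univ (fun k => L k = V₀)]
    congr 1
    rw [← sum_filter_add_sum_filter_not (univ.filter fun k => ¬ L k = V₀) (fun k => L k < V₀), filter_filter, filter_filter]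
    congr 1
    · apply sum_congr _ (fun _ _ => rfl); ext k; simp only [mem_filter, mem_univ, true_and]; omega
    · apply sum_congr _ (fun _ _ => rfl); ext k; simp only [mem_filter, mem_univ, true_and]; omega
  have h1 : ((univ.filter fun k => L k = V₀).card : ℤ) ≤ ∑ k ∈ univ.filter (fun k => L k = V₀), δ k := by
    rw [card_eq_sum_ones, Nat.cast_sum]
    exact sum_le_sum fun k hk => by simpa using hup k (mem_filter.mp hk).2
  have h2 : ∑ k ∈ univ.filter (fun k => L k < V₀), δ k = 0 :=
    sum_eq_zero fun k hk => hstay' k (mem_filter.mp hk).2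
  have h3 : -((ℓ : ℤ) * (univ.filter fun k => V₀ < L k).card) ≤ ∑ k ∈ univ.filter (fun k => V₀ < L k), δ k := by
    rw [card_eq_sum_ones, Nat.cast_sum, mul_sum, ← sum_neg_distrib]
    exact sum_le_sum fun k _ => by simpa using hdrop k
  have hlast := hcm (Fin.last n)
  have hfirst := hc0 0
  have key : ((univ.filter fun k => L k = V₀).card : ℤ) ≤ m + ℓ * (univ.filter fun k => V₀ < L k).card := by
    linarith
  exact_mod_cast key

/-- **descending induction over the values.**  With a level function as above whose values lie in `univ.image d`:
`ℓ·#{steps of level ≥ V} + m ≤ m·(ℓ+1)^{#{exponent values ≥ V}}`.  Pure combinatorics. [folklore] -/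
theorem mul_card_level_ge_add_le (d : Fin K → ℕ) {n : ℕ} (p : Fin (n + 1) → Equiv.Perm (Fin m) × (Fin m → Fin K))
    (ℓ : ℕ)
    (hℓ : ∀ k : Fin n, (univ.filter fun i : Fin m =>
      (p k.castSucc).1 i ≠ (p k.succ).1 i ∨ (p k.castSucc).2 i ≠ (p k.succ).2 i).card ≤ ℓ)
    (L : Fin n → ℕ) (hLmem : ∀ k, L k ∈ univ.image d)
    (hrise : ∀ k, (univ.filter fun i => d ((p k.castSucc).2 i) = L k).card <
      (univ.filter fun i => d ((p k.succ).2 i) = L k).card)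
    (hstay : ∀ k D, L k < D →
      (univ.filter fun i => d ((p k.castSucc).2 i) = D).card = (univ.filter fun i => d ((p k.succ).2 i) = D).card) :
    ∀ (c V : ℕ), ((univ.image d).filter fun D => V ≤ D).card = c →
      ℓ * (univ.filter fun k : Fin n => V ≤ L k).card + m ≤ m * (ℓ + 1) ^ c := by
  intro c
  induction c with
  | zero =>
    intro V hV
    have h0 : (univ.filter fun k : Fin n => V ≤ L k) = ∅ := by
      refine filter_eq_empty_iff.mpr fun k _ hk => ?_
      have hmem : L k ∈ (univ.image d).filter fun D => V ≤ D := mem_filter.mpr ⟨hLmem k, hk⟩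
      rw [card_eq_zero.mp hV] at hmem
      exact absurd hmem (notMem_empty _)
    rw [h0, card_empty, mul_zero, zero_add, pow_zero, mul_one]
  | succ c ih =>
    intro V hV
    set S := (univ.image d).filter fun D => V ≤ D with hS
    have hSne : S.Nonempty := by rw [← card_pos, hV]; exact Nat.succ_pos c
    set V₀ := S.min' hSne with hV₀
    have hV₀mem : V₀ ∈ S := min'_mem S hSne
    have hVV₀ : V ≤ V₀ := (mem_filter.mp hV₀mem).2
    -- every level ≥ V is ≥ V₀
    have hlev : ∀ k, V ≤ L k → V₀ ≤ L k := by
      intro k hk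
      exact min'_le S _ (mem_filter.mpr ⟨hLmem k, hk⟩)
    -- split: level ≥ V  ↔  level = V₀ ∨ level ≥ V₀ + 1
    have hsplit : (univ.filter fun k : Fin n => V ≤ L k).card =
        (univ.filter fun k : Fin n => L k = V₀).card + (univ.filter fun k : Fin n => V₀ + 1 ≤ L k).card := by
      rw [← card_union_of_disjoint]
      · congr 1
        ext k
        simp only [mem_filter, mem_union, mem_univ, true_and]
        constructor
        · intro hk; have := hlev k hk; omega
        · intro hk; rcases hk with hk | hk <;> omega
      · rw [disjoint_filter]; intro k _ h1; omega
    -- the values ≥ V₀ + 1 are S minus its minimum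
    have hcard : ((univ.image d).filter fun D => V₀ + 1 ≤ D).card = c := by
      have hE : ((univ.image d).filter fun D => V₀ + 1 ≤ D) = S.erase V₀ := by
        ext D
        simp only [hS, mem_filter, mem_erase]
        constructor
        · rintro ⟨hD, hle⟩; exact ⟨by omega, hD, by omega⟩
        · rintro ⟨hne, hD, hle⟩
          have : V₀ ≤ D := min'_le S D (mem_filter.mpr ⟨hD, hle⟩)
          exact ⟨hD, by omega⟩
      rw [hE, card_erase_of_mem hV₀mem, hV]
      rfl
    have hIH := ih (V₀ + 1) hcard
    have hM := card_level_eq_le d p ℓ hℓ L hrise hstay V₀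
    have hgt : (univ.filter fun k : Fin n => V₀ < L k) = (univ.filter fun k : Fin n => V₀ + 1 ≤ L k) := by
      ext k; simp only [mem_filter, mem_univ, true_and]; omega
    rw [hgt] at hM
    rw [hsplit]
    set M := (univ.filter fun k : Fin n => L k = V₀).card
    set U := (univ.filter fun k : Fin n => V₀ + 1 ≤ L k).card
    calc ℓ * (M + U) + m ≤ ℓ * (m + ℓ * U + U) + m := by nlinarith
      _ = (ℓ + 1) * (ℓ * U + m) := by ring
      _ ≤ (ℓ + 1) * (m * (ℓ + 1) ^ c) := Nat.mul_le_mul_left _ hIH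
      _ = m * (ℓ + 1) ^ (c + 1) := by ring

/-! ## 2. The bound for dominant chains of lex designs -/

/-- **SHORT STEPS ⇒ LINEAR** (lex regime).  If the exponent values are super-increasing by the size and every step of the
dominant sign-alternating chain changes at most `ℓ` columns (row or class), then `ℓ·n + m ≤ m·(ℓ+1)^K`.  The level function
is supplied by `exists_lex_strict_step`. [folklore] -/
theorem mul_steps_add_le_of_shortSteps (d : Fin K → ℕ) (hsup : ∀ l l' : Fin K, d l < d l' → m * d l < d l')
    (v ε : Fin m → Fin m → Fin K → ℤ) {n : ℕ} (θ : Fin (n + 1) → ℤ)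
    (p : Fin (n + 1) → Equiv.Perm (Fin m) × (Fin m → Fin K)) (hθ : StrictMono θ)
    (hdom : ∀ k, IsDominant d v ε (θ k) (p k))
    (halt : ∀ k : Fin n, termSign ε (p k.castSucc) * termSign ε (p k.succ) < 0) (ℓ : ℕ)
    (hℓ : ∀ k : Fin n, (univ.filter fun i : Fin m =>
      (p k.castSucc).1 i ≠ (p k.succ).1 i ∨ (p k.castSucc).2 i ≠ (p k.succ).2 i).card ≤ ℓ) :
    ℓ * n + m ≤ m * (ℓ + 1) ^ K := by
  -- the level of each step
  have hex : ∀ k : Fin n, ∃ t : Fin K, (∀ D : ℕ, d t < D →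
        (univ.filter fun i => d ((p k.castSucc).2 i) = D).card = (univ.filter fun i => d ((p k.succ).2 i) = D).card) ∧
      (univ.filter fun i => d ((p k.castSucc).2 i) = d t).card < (univ.filter fun i => d ((p k.succ).2 i) = d t).card :=
    fun k => exists_lex_strict_step d hsup v ε (hθ (Fin.castSucc_lt_succ (i := k)))
      (Summit.ValiantsHypothesis.ValiantsHypothesis.Theorems.KPlusLogSqLaw.ne_succ_of_alternating ε p halt k)
      (hdom k.castSucc) (hdom k.succ)
  choose t ht using hex
  have h := mul_card_level_ge_add_le d p ℓ hℓ (fun k => d (t k)) (fun k => mem_image_of_mem d (mem_univ _))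
    (fun k => (ht k).2) (fun k D hD => (ht k).1 D hD) _ 0 rfl
  have hall : (univ.filter fun k : Fin n => 0 ≤ d (t k)) = univ := filter_true_of_mem fun k _ => Nat.zero_le _
  rw [hall, card_univ, Fintype.card_fin] at h
  have hK : ((univ.image d).filter fun D => 0 ≤ D).card ≤ K := by
    calc ((univ.image d).filter fun D => 0 ≤ D).card ≤ (univ.image d).card := card_filter_le _ _
      _ ≤ (univ : Finset (Fin K)).card := card_image_le
      _ = K := by rw [card_univ, Fintype.card_fin]
  exact h.trans (Nat.mul_le_mul_left _ (Nat.pow_le_pow_right (Nat.succ_pos ℓ) hK))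

/-- **SHORT STEPS ⇒ LINEAR**, solved for `n`: under the same hypotheses with `ℓ ≥ 1`, `n ≤ m·(ℓ+1)^K` — linear in the size,
inside the `K + log₂² m` budget with a constant `≈ log₂(ℓ+1)`; beating it requires a step changing more than `ℓ` columns. [folklore] -/
theorem steps_le_of_shortSteps (d : Fin K → ℕ) (hsup : ∀ l l' : Fin K, d l < d l' → m * d l < d l')
    (v ε : Fin m → Fin m → Fin K → ℤ) {n : ℕ} (θ : Fin (n + 1) → ℤ)
    (p : Fin (n + 1) → Equiv.Perm (Fin m) × (Fin m → Fin K)) (hθ : StrictMono θ)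
    (hdom : ∀ k, IsDominant d v ε (θ k) (p k))
    (halt : ∀ k : Fin n, termSign ε (p k.castSucc) * termSign ε (p k.succ) < 0) (ℓ : ℕ) (hℓ1 : 1 ≤ ℓ)
    (hℓ : ∀ k : Fin n, (univ.filter fun i : Fin m =>
      (p k.castSucc).1 i ≠ (p k.succ).1 i ∨ (p k.castSucc).2 i ≠ (p k.succ).2 i).card ≤ ℓ) :
    n ≤ m * (ℓ + 1) ^ K := by
  have h := mul_steps_add_le_of_shortSteps d hsup v ε θ p hθ hdom halt ℓ hℓ
  nlinarith

end ShortSteps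

end Summit.ValiantsHypothesis.ValiantsHypothesis.Theorems.LacunarySymmetroidMatrixDescartes.TropicalCensus
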